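import Literature.NumberTheory.GaloisRepresentations.HilbertNinetySubgroup
import Literature.NumberTheory.GaloisRepresentations.KummerSES
import Literature.NumberTheory.GaloisRepresentations.CyclicLayer
import Literature.NumberTheory.GaloisRepresentations.ShapiroVanishing
import Mathlib.RingTheory.Norm.Transitivity
import Mathlib.FieldTheory.Perfect
import HarnessLib

/-!
# The cyclic layer `H²(Γ(E)/Γ(E'), (K̄ˣ)^{Γ(E')}) = 0` from norm surjectivity (Serre II §3.1 Prop. 5)

Setting: `k` a field, `K̄` its algebraic closure, `Γ_k` its absolute Galois group; `L₁/k` a finite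
Galois subextension of `K̄` with group `G₁ = Gal(L₁/k)`; subgroups `D' ≤ D ≤ G₁` with `D'` normal
in `D`; `E = L₁^D ⊆ E' = L₁^{D'}`, and `N = Gal(K̄/E) = D⁻¹`, `N' = Gal(K̄/E') = D'⁻¹ ≤ Γ_k`
(preimages under the restriction `resGal L₁`).  This file proves the step
"(iv) bis ⇒ `H²` of the layer vanishes" of Serre, *Cohomologie galoisienne* II §3.1 Prop. 5 for
the discrete module `K̄ˣ`:

* `galQuotEquiv` — `N/N' ≃ Gal(E'/E)` (restriction), compatible with the actions on `E' ⊆ K̄`;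
* `exists_norm_eq_of_norm_surjective` — if the norms `N_{L/K} : L → K` are onto for all finite
  separable `K/k` and finite Galois `L/K` (hypothesis (iv) bis), then every `N`-invariant unit of
  `K̄` is the norm `Π_{c ∈ N/N'} c · b'` of an `N'`-invariant unit `b'` (for `x` in the perfect
  closure of `E` one takes `q^m`-th roots, `q` the characteristic exponent: `x^{q^m} ∈ E` is a norm
  from `E'`, and `q^m`-th roots are unique in `K̄`);
* `exists_d_eq_of_layer` — consequently (with Hilbert 90 for `Gal(K̄/E')`,
  `subsingleton_one_units_galFixing`, the cyclic-group computation
  `subsingleton_two_of_forall_exists_norm_eq` when `(D : D') = p` is prime, and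
  inflation–restriction in degree `2`, `exists_d_eq_of_res_eq_d_two`): a `2`-cocycle of
  `N` with values in `K̄ˣ` whose restriction to `N'` is a coboundary is a coboundary.

## References

* J.-P. Serre, *Cohomologie galoisienne* (1997), II §3.1 Prop. 5, proof of (iv) ⇒ (iii) ⇒ (ii)
  ("[145], p. 169": *Corps locaux* X §7 Prop. 11, VIII §4, IX §2). [SerreGaloisCohomology1997]
* J.-P. Serre, *Corps locaux* (1968), VIII §4, X §7. [SerreLocalFields1979]
-/

noncomputable section

open CategoryTheory Topology Field IntermediateField

universe u

namespace Literature.NumberTheory.GaloisRepresentations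

open _root_.TopRep _root_.ContRepresentation _root_.ContinuousCohomology DiscreteGaloisModule
  LocalWeilDatum

/-! ### The Galois group of a layer as a quotient of fixing subgroups of `Γ_k` -/

section Layer

variable {k : Type u} [Field k]
variable (L₁ : IntermediateField k (AlgebraicClosure k)) [FiniteDimensional k L₁] [IsGalois k L₁]
variable (D D' : Subgroup (L₁ ≃ₐ[k] L₁))

/-- The base of the layer: `E = L₁^D`. [folklore] -/
abbrev layerBase : IntermediateField k L₁ := fixedField D

/-- `Gal(L₁/E')` inside `Gal(L₁/E)`: the subgroup of `E`-automorphisms of `L₁` whose underlying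
`k`-automorphism lies in `D'`. [folklore] -/
def layerSubgroup : Subgroup (L₁ ≃ₐ[layerBase L₁ D] L₁) :=
  D'.comap ((fixingSubgroup (layerBase L₁ D)).subtype.comp
    (fixingSubgroupEquiv (layerBase L₁ D)).symm.toMonoidHom)

omit [FiniteDimensional k L₁] [IsGalois k L₁] in
/-- Membership in `layerSubgroup`: the restriction of scalars lies in `D'`. [folklore] -/
theorem mem_layerSubgroup_iff (φ : L₁ ≃ₐ[layerBase L₁ D] L₁) :
    φ ∈ layerSubgroup L₁ D D' ↔ φ.restrictScalars k ∈ D' := Iff.rfl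

omit [IsGalois k L₁] in
variable {D D'} in
/-- `layerSubgroup` is normal when `D'` is normalised by `D`. [folklore] -/
theorem normal_layerSubgroup (hDD : D' ≤ D) (hn : (D'.subgroupOf D).Normal) :
    (layerSubgroup L₁ D D').Normal := by
  refine ⟨fun φ hφ ψ => ?_⟩
  rw [mem_layerSubgroup_iff] at hφ ⊢
  have hψ : ψ.restrictScalars k ∈ D :=
    (fixingSubgroup_fixedField D).le
      ((IntermediateField.mem_fixingSubgroup_iff _ _).2 fun x hx => ψ.commutes ⟨x, hx⟩)
  have h := hn.conj_mem ⟨φ.restrictScalars k, hDD hφ⟩ hφ ⟨ψ.restrictScalars k, hψ⟩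
  exact h

/-- The top of the layer over `E`: `E'` as an intermediate field of `L₁/E`, the fixed field of
`layerSubgroup`. [folklore] -/
abbrev layerTop : IntermediateField (layerBase L₁ D) L₁ := fixedField (layerSubgroup L₁ D D')

omit [IsGalois k L₁] in
variable {D D'} in
/-- Membership in `layerTop`: for `D' ≤ D`, `x ∈ E'` iff `x` is fixed by `D'`. [folklore] -/
theorem mem_layerTop_iff (hDD : D' ≤ D) (x : L₁) :
    x ∈ layerTop L₁ D D' ↔ ∀ τ ∈ D', τ x = x := by
  rw [layerTop, IntermediateField.mem_fixedField_iff]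
  constructor
  · intro h τ hτ
    have hτD : τ ∈ fixingSubgroup (layerBase L₁ D) := by
      rw [fixingSubgroup_fixedField]
      exact hDD hτ
    have h1 := h (fixingSubgroupEquiv (layerBase L₁ D) ⟨τ, hτD⟩) (by
      rw [mem_layerSubgroup_iff]
      exact hτ)
    exact h1
  · intro h φ hφ
    exact h _ ((mem_layerSubgroup_iff L₁ D D' φ).1 hφ)

variable {D D'} in
/-- `E'/E` is Galois when `D'` is normalised by `D`. [folklore] -/
theorem isGalois_layerTop (hDD : D' ≤ D) (hn : (D'.subgroupOf D).Normal) :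
    IsGalois (layerBase L₁ D) (layerTop L₁ D D') := by
  haveI := normal_layerSubgroup L₁ hDD hn
  exact IsGalois.of_fixedField_normal_subgroup _

/-- `N = Gal(K̄/E) = D⁻¹ ≤ Γ_k`. [folklore] -/
abbrev layerN : Subgroup (absoluteGaloisGroup k) := D.comap (resGal L₁)

/-- `layerN` is the fixing subgroup of `E` lifted to `K̄`. [folklore] -/
theorem layerN_eq_galFixing : layerN L₁ D = galFixing k (lift (fixedField D)) :=
  (galFixing_lift_fixedField L₁ D).symm

/-- `N' = Gal(K̄/E') = D'⁻¹ ≤ Γ_k`. [folklore] -/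
abbrev layerN' : Subgroup (absoluteGaloisGroup k) := D'.comap (resGal L₁)

omit [FiniteDimensional k L₁] in
variable {D D'} in
/-- `N' ≤ N` when `D' ≤ D`. [folklore] -/
theorem layerN'_le (hDD : D' ≤ D) : layerN' L₁ D' ≤ layerN L₁ D := Subgroup.comap_mono hDD

omit [FiniteDimensional k L₁] in
variable {D D'} in
/-- `N'` is normal in `N` when `D'` is normalised by `D`. [folklore] -/
theorem normal_layerN'_subgroupOf (hDD : D' ≤ D) (hn : (D'.subgroupOf D).Normal) :
    ((layerN' L₁ D').subgroupOf (layerN L₁ D)).Normal := by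
  refine ⟨fun m hm n => ?_⟩
  rw [Subgroup.mem_subgroupOf, Subgroup.mem_comap] at hm ⊢
  have h := hn.conj_mem ⟨resGal L₁ (m : absoluteGaloisGroup k), hDD hm⟩ hm
    ⟨resGal L₁ (n : absoluteGaloisGroup k), n.2⟩
  simpa only [Subgroup.mem_subgroupOf, Subgroup.coe_mul, Subgroup.coe_inv, Subgroup.coe_mk,
    map_mul, map_inv] using h

/-- The restriction of `n ∈ N` to `L₁`, as an `E`-automorphism. [folklore] -/
def layerResL₁ : layerN L₁ D →* (L₁ ≃ₐ[layerBase L₁ D] L₁) :=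
  (fixingSubgroupEquiv (layerBase L₁ D)).toMonoidHom.comp
    (((resGal L₁).comp (layerN L₁ D).subtype).codRestrict (fixingSubgroup (layerBase L₁ D))
      fun n => by
        rw [fixingSubgroup_fixedField]
        exact n.2)

/-- `layerResL₁ n` acts on `L₁` as `resGal L₁ n`. [folklore] -/
@[simp] theorem layerResL₁_apply (n : layerN L₁ D) (y : L₁) :
    layerResL₁ L₁ D n y = resGal L₁ (n : absoluteGaloisGroup k) y := rfl

variable {D D'}
variable (hDD : D' ≤ D) (hn : (D'.subgroupOf D).Normal)

/-- The restriction `N → Gal(E'/E)` (through `L₁`), for `D'` normalised by `D`. [folklore] -/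
def layerRes : layerN L₁ D →* (layerTop L₁ D D' ≃ₐ[layerBase L₁ D] layerTop L₁ D D') :=
  haveI := (isGalois_layerTop L₁ hDD hn).to_normal
  (AlgEquiv.restrictNormalHom (layerTop L₁ D D')).comp (layerResL₁ L₁ D)

include hDD hn in
/-- `layerRes n` acts on `E' ⊆ K̄` as `n`. [folklore] -/
theorem coe_layerRes_apply (n : layerN L₁ D) (x : layerTop L₁ D D') :
    (((layerRes L₁ hDD hn n x : layerTop L₁ D D') : L₁) : AlgebraicClosure k) =
      (n : absoluteGaloisGroup k) • ((x : L₁) : AlgebraicClosure k) := by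
  haveI := (isGalois_layerTop L₁ hDD hn).to_normal
  rw [← coe_resGal_apply, ← layerResL₁_apply]
  exact congrArg (fun z : L₁ => (z : AlgebraicClosure k))
    (AlgEquiv.restrictNormalHom_apply (layerTop L₁ D D') (layerResL₁ L₁ D n) x)

include hDD hn in
/-- `N'` acts trivially on `E'` through `layerRes`. [folklore] -/
theorem layerRes_eq_one_of_mem (n : layerN L₁ D)
    (hn' : (n : absoluteGaloisGroup k) ∈ layerN' L₁ D') :
    layerRes L₁ hDD hn n = 1 := by
  ext x
  rw [coe_layerRes_apply, AlgEquiv.one_apply, ← coe_resGal_apply]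
  exact congrArg (fun z : L₁ => (z : AlgebraicClosure k))
    ((mem_layerTop_iff L₁ hDD (x : L₁)).1 x.2 _ hn')

variable [((layerN' L₁ D').subgroupOf (layerN L₁ D)).Normal]

/-- **`N/N' → Gal(E'/E)`**, the restriction, as a homomorphism from the quotient (the normality
instance is `normal_layerN'_subgroupOf`). [folklore] -/
def layerQuotRes : layerN L₁ D ⧸ (layerN' L₁ D').subgroupOf (layerN L₁ D) →*
    (layerTop L₁ D D' ≃ₐ[layerBase L₁ D] layerTop L₁ D D') :=
  QuotientGroup.lift _ (layerRes L₁ hDD hn) fun n hn' => layerRes_eq_one_of_mem L₁ hDD hn n hn'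

/-- `layerQuotRes` on classes. [folklore] -/
@[simp] theorem layerQuotRes_mk (n : layerN L₁ D) :
    layerQuotRes L₁ hDD hn (n : layerN L₁ D ⧸ (layerN' L₁ D').subgroupOf (layerN L₁ D)) =
      layerRes L₁ hDD hn n := rfl

include hDD hn in
/-- **`N/N' ≃ Gal(E'/E)` is a bijection**: injective because an element of `N` acting trivially
on `E'` lies in `N'` (`fixingSubgroup_fixedField`), surjective by extending automorphisms of `E'`
to `L₁` (`AlgEquiv.liftNormal`) and to `K̄` (`resGal_surjective`). [folklore] -/
theorem layerQuotRes_bijective : Function.Bijective (layerQuotRes L₁ hDD hn) := by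
  haveI := (isGalois_layerTop L₁ hDD hn).to_normal
  constructor
  · rw [← MonoidHom.ker_eq_bot_iff, eq_bot_iff]
    intro c hc
    induction c using QuotientGroup.induction_on with
    | H n =>
      rw [MonoidHom.mem_ker, layerQuotRes_mk] at hc
      rw [Subgroup.mem_bot, QuotientGroup.eq_one_iff, Subgroup.mem_subgroupOf, Subgroup.mem_comap,
        ← fixingSubgroup_fixedField D', IntermediateField.mem_fixingSubgroup_iff]
      intro x hx
      have hx' : x ∈ layerTop L₁ D D' :=
        (mem_layerTop_iff L₁ hDD x).2 ((IntermediateField.mem_fixedField_iff _ _).1 hx)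
      have h1 := congrArg (fun ψ : layerTop L₁ D D' ≃ₐ[layerBase L₁ D] layerTop L₁ D D' =>
        (((ψ ⟨x, hx'⟩ : layerTop L₁ D D') : L₁) : AlgebraicClosure k)) hc
      simp only [coe_layerRes_apply, AlgEquiv.one_apply] at h1
      apply (algebraMap L₁ (AlgebraicClosure k)).injective
      rw [← coe_resGal_apply] at h1
      exact h1
  · intro ψ
    let ψ₁ : L₁ ≃ₐ[layerBase L₁ D] L₁ := AlgEquiv.liftNormal ψ L₁
    obtain ⟨n₀, hn₀⟩ := resGal_surjective L₁ (ψ₁.restrictScalars k)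
    have hn₀N : n₀ ∈ layerN L₁ D := by
      rw [Subgroup.mem_comap, hn₀]
      exact (fixingSubgroup_fixedField D).le
        ((IntermediateField.mem_fixingSubgroup_iff _ _).2 fun x hx => ψ₁.commutes ⟨x, hx⟩)
    refine ⟨(⟨n₀, hn₀N⟩ : layerN L₁ D), ?_⟩
    rw [layerQuotRes_mk]
    ext x
    rw [coe_layerRes_apply]
    change n₀ • ((x : L₁) : AlgebraicClosure k) = _
    rw [← coe_resGal_apply, hn₀]
    exact congrArg (fun z : L₁ => (z : AlgebraicClosure k)) (AlgEquiv.liftNormal_commutes ψ L₁ x)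

/-- `N/N' ≃ Gal(E'/E)` as an equivalence. [folklore] -/
def galQuotEquiv : layerN L₁ D ⧸ (layerN' L₁ D').subgroupOf (layerN L₁ D) ≃
    (layerTop L₁ D D' ≃ₐ[layerBase L₁ D] layerTop L₁ D D') :=
  Equiv.ofBijective _ (layerQuotRes_bijective L₁ hDD hn)

include hDD hn in
/-- **The norm of the layer as a product over `N/N'`**: for `y ∈ E'`,
`Π_{c ∈ N/N'} c · y = N_{E'/E}(y)` in `K̄` (Mathlib `Algebra.norm_eq_prod_automorphisms` transported
through `galQuotEquiv`). [cite: SerreLocalFields1979, VIII §1] -/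
theorem prod_layerQuotRes_eq_norm
    [Fintype (layerN L₁ D ⧸ (layerN' L₁ D').subgroupOf (layerN L₁ D))] (y : layerTop L₁ D D') :
    ∏ c : layerN L₁ D ⧸ (layerN' L₁ D').subgroupOf (layerN L₁ D),
        (((layerQuotRes L₁ hDD hn c y : layerTop L₁ D D') : L₁) : AlgebraicClosure k) =
      (((algebraMap (layerBase L₁ D) (layerTop L₁ D D') (Algebra.norm (layerBase L₁ D) y) :
        layerTop L₁ D D') : L₁) : AlgebraicClosure k) := by
  haveI := isGalois_layerTop L₁ hDD hn
  rw [Algebra.norm_eq_prod_automorphisms]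
  let f : layerTop L₁ D D' →+* AlgebraicClosure k :=
    (algebraMap L₁ (AlgebraicClosure k)).comp (algebraMap (layerTop L₁ D D') L₁)
  change ∏ c, f (layerQuotRes L₁ hDD hn c y) =
    f (∏ σ : layerTop L₁ D D' ≃ₐ[layerBase L₁ D] layerTop L₁ D D', σ y)
  rw [map_prod]
  exact Fintype.prod_equiv (galQuotEquiv L₁ hDD hn) _ _ fun c => rfl

/-! ### Invariant units are norms from the layer above (hypothesis (iv) bis) -/

/-- **An element of `K̄` fixed by `Gal(K̄/F)` has a `q^m`-th power in `F`** (`q` the characteristic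
exponent): the tree's `exists_pow_mem_range_of_forall_algEquiv` for the normal extension `K̄/F`,
transported along `galFixingOfAlgEquiv`. [folklore] -/
theorem exists_pow_mem_of_forall_smul_eq (F : IntermediateField k (AlgebraicClosure k))
    (x : AlgebraicClosure k) (hx : ∀ σ ∈ galFixing k F, σ • x = x) :
    ∃ m : ℕ, x ^ ringExpChar k ^ m ∈ F := by
  haveI := normal_algebraicClosure_intermediateField F
  haveI : ExpChar F (ringExpChar k) :=
    expChar_of_injective_algebraMap (algebraMap k F).injective _
  obtain ⟨m, e, he⟩ := exists_pow_mem_range_of_forall_algEquiv (F := F) (L := AlgebraicClosure k)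
    (ringExpChar k) (x := x) fun σ => by
      have h := hx _ (galFixingOfAlgEquiv F σ).2
      rwa [coe_galFixingOfAlgEquiv_smul] at h
  exact ⟨m, he ▸ e.2⟩

/-- `unitsVal` of a finite sum is the product. [folklore] -/
theorem unitsVal_sum {ι : Type*} (t : Finset ι) (f : ι → UnitsCarrier k) :
    unitsVal k (∑ i ∈ t, f i) = ∏ i ∈ t, unitsVal k (f i) := by
  classical
  induction t using Finset.induction_on with
  | empty => rfl
  | insert i t hi ih => rw [Finset.sum_insert hi, Finset.prod_insert hi, unitsVal_add, ih]

variable (D) in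
/-- The `N`-module `K̄ˣ` of the layer. [folklore] -/
abbrev layerRep : ContinuousRep (layerN L₁ D) ℤ (UnitsCarrier k) :=
  (units k).restrict (subgroupIncl (layerN L₁ D))

variable (D D') in
/-- The normal subgroup `N' ∩ N ≤ N` of the layer. [folklore] -/
abbrev layerS : Subgroup (layerN L₁ D) := (layerN' L₁ D').subgroupOf (layerN L₁ D)

set_option synthInstance.maxHeartbeats 100000 in
include hDD hn in
/-- **Invariant units are norms from the layer above** (the use of hypothesis (iv) bis in
Serre II §3.1 Prop. 5): if the norm maps `N_{L/K}` are onto for all finite separable `K/k` and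
finite Galois `L/K`, then every `N`-invariant element of the `N/N'`-module `(K̄ˣ)^{N'}` is a norm
`Σ_{c ∈ N/N'} c · b'`.  For `x` fixed by `N = Gal(K̄/E)` some `x^{q^m}` lies in `E`
(`exists_pow_mem_of_forall_smul_eq`), is a norm `N_{E'/E}(y)` by hypothesis, i.e.
`Π_{c ∈ N/N'} c · y` (`prod_layerQuotRes_eq_norm`), and the unique `q^m`-th root of `y` in `K̄`
(`iterateFrobeniusEquiv`) is `N'`-invariant with norm `x`.
[cite: SerreGaloisCohomology1997, II §3.1 Prop. 5 ((iv) bis ⇒ (iii))] -/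
theorem exists_norm_eq_of_norm_surjective
    (hNorm : ∀ (K L : Type u) [Field K] [Field L] [Algebra k K] [Algebra K L]
      [FiniteDimensional k K] [Algebra.IsSeparable k K] [FiniteDimensional K L] [IsGalois K L],
      Function.Surjective (Algebra.norm K (S := L)))
    [Fintype (layerN L₁ D ⧸ layerS L₁ D D')]
    (b : (layerRep L₁ D).invariantsOf (layerS L₁ D D'))
    (hb : ∀ c : layerN L₁ D ⧸ layerS L₁ D D',
      (layerRep L₁ D).quotientInvariants (layerS L₁ D D') c b = b) :
    ∃ b' : (layerRep L₁ D).invariantsOf (layerS L₁ D D'),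
      ((layerRep L₁ D).quotientInvariants (layerS L₁ D D')).toRepresentation.norm b' = b := by
  classical
  set q : ℕ := ringExpChar k with hq
  haveI hqK : ExpChar (AlgebraicClosure k) q :=
    expChar_of_injective_algebraMap (algebraMap k (AlgebraicClosure k)).injective q
  have hq0 : 0 < q := expChar_pos k q
  -- the unit `x` and its `N`-invariance
  set x : (AlgebraicClosure k)ˣ := unitsVal k (b : UnitsCarrier k) with hxdef
  have hxN : ∀ n : layerN L₁ D, (n : absoluteGaloisGroup k) • (x : AlgebraicClosure k) = x := by
    intro n
    have h := congrArg (fun w : (layerRep L₁ D).invariantsOf (layerS L₁ D D') =>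
      ((unitsVal k (w : UnitsCarrier k) : (AlgebraicClosure k)ˣ) : AlgebraicClosure k))
      (hb (n : layerN L₁ D ⧸ layerS L₁ D D'))
    simp only [ContinuousRep.quotientInvariants_apply_coe, ContinuousRep.restrict_apply,
      subgroupIncl_apply, unitsVal_apply, Units.coe_smul] at h
    exact h
  -- `x ^ q ^ m ∈ E`
  have hxfix : ∀ σ ∈ galFixing k (lift (fixedField D)), σ • (x : AlgebraicClosure k) = x := by
    intro σ hσ
    rw [← layerN_eq_galFixing] at hσ
    exact hxN ⟨σ, hσ⟩
  obtain ⟨m, hm⟩ := exists_pow_mem_of_forall_smul_eq (lift (fixedField D)) (x : AlgebraicClosure k)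
    hxfix
  have hmL : (x : AlgebraicClosure k) ^ q ^ m ∈ L₁ := lift_le _ hm
  have hmE : (⟨(x : AlgebraicClosure k) ^ q ^ m, hmL⟩ : L₁) ∈ layerBase L₁ D :=
    (mem_lift ⟨_, hmL⟩).1 hm
  set e₁ : layerBase L₁ D := ⟨⟨(x : AlgebraicClosure k) ^ q ^ m, hmL⟩, hmE⟩ with he₁
  have he₁K : (((e₁ : layerBase L₁ D) : L₁) : AlgebraicClosure k) =
      (x : AlgebraicClosure k) ^ q ^ m := rfl
  -- hypothesis (iv) bis for `E'/E`
  haveI := isGalois_layerTop L₁ hDD hn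
  haveI : Algebra.IsSeparable k (layerBase L₁ D) :=
    Algebra.isSeparable_tower_bot_of_isSeparable k (layerBase L₁ D) L₁
  haveI : FiniteDimensional (layerBase L₁ D) L₁ := IntermediateField.finiteDimensional_right _
  haveI : FiniteDimensional (layerBase L₁ D) (layerTop L₁ D D') :=
    IntermediateField.finiteDimensional_left _
  haveI : Module.Free (layerBase L₁ D) (layerTop L₁ D D') := Module.Free.of_divisionRing _ _
  obtain ⟨y, hy⟩ := hNorm (layerBase L₁ D) (layerTop L₁ D D') e₁
  -- the norm identity in `K̄`
  have hprod : ∏ c : layerN L₁ D ⧸ layerS L₁ D D',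
      (((layerQuotRes L₁ hDD hn c y : layerTop L₁ D D') : L₁) : AlgebraicClosure k) =
      (x : AlgebraicClosure k) ^ q ^ m := by
    rw [prod_layerQuotRes_eq_norm L₁ hDD hn y, hy]
    rfl
  -- `y ≠ 0` and the root `r` of `y`
  have hy0 : (((y : layerTop L₁ D D') : L₁) : AlgebraicClosure k) ≠ 0 := by
    intro h0
    have hy' : y = 0 := by
      apply Subtype.ext
      apply Subtype.ext
      exact h0
    rw [hy', Algebra.norm_zero] at hy
    have h2 : (x : AlgebraicClosure k) ^ q ^ m = 0 := by
      rw [← he₁K, ← hy]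
      rfl
    exact (pow_ne_zero _ x.ne_zero) h2
  set r : AlgebraicClosure k := (iterateFrobeniusEquiv (AlgebraicClosure k) q m).symm
    (((y : layerTop L₁ D D') : L₁) : AlgebraicClosure k) with hrdef
  have hrq : r ^ q ^ m = (((y : layerTop L₁ D D') : L₁) : AlgebraicClosure k) := by
    rw [← iterateFrobeniusEquiv_def, hrdef, RingEquiv.apply_symm_apply]
  have hr0 : r ≠ 0 := by
    intro h
    apply hy0
    rw [← hrq, h, zero_pow (pow_ne_zero m hq0.ne')]
  -- `r` is `N'`-invariant
  have hrN' : ∀ n : layerN L₁ D, (n : absoluteGaloisGroup k) ∈ layerN' L₁ D' →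
      (n : absoluteGaloisGroup k) • r = r := by
    intro n hn'
    apply (iterateFrobeniusEquiv (AlgebraicClosure k) q m).injective
    rw [iterateFrobeniusEquiv_def, iterateFrobeniusEquiv_def, ← smul_pow', hrq,
      ← coe_resGal_apply]
    exact congrArg (fun z : L₁ => (z : AlgebraicClosure k))
      ((mem_layerTop_iff L₁ hDD ((y : layerTop L₁ D D') : L₁)).1 y.2 _ hn')
  -- the `N'`-invariant unit `b'`
  let u : (AlgebraicClosure k)ˣ := Units.mk0 r hr0
  have hb'mem : UnitsCarrier.ofUnits u ∈ (layerRep L₁ D).invariantsOf (layerS L₁ D D') := by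
    rw [ContinuousRep.mem_invariantsOf_iff]
    rintro ⟨n, hnS⟩
    apply unitsVal_injective k
    apply Units.ext
    have h1 : ((unitsVal k (units k ((n : layerN L₁ D) : absoluteGaloisGroup k)
        (UnitsCarrier.ofUnits u)) : (AlgebraicClosure k)ˣ) : AlgebraicClosure k) =
        (n : absoluteGaloisGroup k) • r := by
      rw [unitsVal_apply, unitsVal_ofUnits, Units.coe_smul]
      rfl
    exact h1.trans (hrN' n hnS)
  refine ⟨⟨_, hb'mem⟩, ?_⟩
  -- `Σ_c c · b' = b`: compare `q ^ m`-th powers in `K̄`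
  apply Subtype.ext
  apply unitsVal_injective k
  apply Units.ext
  apply (iterateFrobeniusEquiv (AlgebraicClosure k) q m).injective
  rw [iterateFrobeniusEquiv_def, iterateFrobeniusEquiv_def, ← hxdef, ← hprod, norm_apply,
    Submodule.coe_sum, unitsVal_sum, Units.coe_prod, ← Finset.prod_pow]
  refine Finset.prod_congr rfl ?_
  intro c _
  obtain ⟨n, rfl⟩ := QuotientGroup.mk_surjective c
  rw [layerQuotRes_mk, coe_layerRes_apply, ← hrq, smul_pow']
  congr 1

/-! ### The layer lemma -/

include hDD in
/-- The continuous isomorphism `N' ∩ N ≃ Gal(K̄/E')` (both are `N'`). [folklore] -/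
def layerSEquiv : layerS L₁ D D' ≃ₜ* galFixing k (lift (fixedField D')) :=
  let e : layerS L₁ D D' ≃* galFixing k (lift (fixedField D')) :=
    (Subgroup.subgroupOfEquivOfLe (layerN'_le L₁ hDD)).trans
      (MulEquiv.subgroupCongr (galFixing_lift_fixedField L₁ D').symm)
  { e with
    continuous_toFun := continuous_induced_rng.2
      ((continuous_subtype_val.comp continuous_subtype_val :
        Continuous fun x : layerS L₁ D D' => ((x : layerN L₁ D) : absoluteGaloisGroup k)))
    continuous_invFun := continuous_induced_rng.2 (continuous_induced_rng.2
      (continuous_subtype_val :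
        Continuous fun y : galFixing k (lift (fixedField D')) => (y : absoluteGaloisGroup k))) }

attribute [local instance] compactSpace_of_isClosed_subgroup

omit [((layerN' L₁ D').subgroupOf (layerN L₁ D)).Normal] in
include hDD hn in
/-- **The layer lemma**: under hypothesis (iv) bis, if `(D : D') = p` is prime, a homogeneous
`2`-cocycle of `N = Gal(K̄/E)` with values in `K̄ˣ` whose restriction to `N' = Gal(K̄/E')` is a
coboundary is a coboundary.  Inflation–restriction in degree two (`exists_d_eq_of_res_eq_d_two`)
with `H¹(N', K̄ˣ) = 0` (Hilbert 90, `subsingleton_one_units_galFixing`, transported along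
`layerSEquiv`) and `H²(N/N', (K̄ˣ)^{N'}) = 0` (cyclic group of prime order, invariants are norms:
`subsingleton_two_of_forall_exists_norm_eq` with `exists_norm_eq_of_norm_surjective`).
[cite: SerreGaloisCohomology1997, II §3.1 Prop. 5 ((iv) bis ⇒ (ii))]
[cite: SerreLocalFields1979, X §7 Prop. 11] -/
theorem exists_d_eq_of_layer {p : ℕ} [hp : Fact p.Prime]
    (hNorm : ∀ (K L : Type u) [Field K] [Field L] [Algebra k K] [Algebra K L]
      [FiniteDimensional k K] [Algebra.IsSeparable k K] [FiniteDimensional K L] [IsGalois K L],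
      Function.Surjective (Algebra.norm K (S := L)))
    (hindex : D'.relIndex D = p)
    (a : (homogeneousCochains (layerRep L₁ D).toTopRep).X 2)
    (ha : (homogeneousCochains (layerRep L₁ D).toTopRep).d 2 3 a = 0)
    (hres : ∃ z : (homogeneousCochains ((layerRep L₁ D).restrict
        (subgroupIncl (layerS L₁ D D'))).toTopRep).X 1,
      (homogeneousCochains ((layerRep L₁ D).restrict (subgroupIncl (layerS L₁ D D'))).toTopRep).d
        1 2 z = (resCochains (layerS L₁ D D') (layerRep L₁ D)).f 2 a) :
    ∃ b : (homogeneousCochains (layerRep L₁ D).toTopRep).X 1,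
      (homogeneousCochains (layerRep L₁ D).toTopRep).d 1 2 b = a := by
  classical
  haveI := absoluteGaloisGroup_compactSpace k
  haveI : FiniteDimensional k (lift (fixedField D')) :=
    (liftAlgEquiv (fixedField D')).toLinearEquiv.finiteDimensional
  haveI : FiniteDimensional k (lift (fixedField D)) :=
    (liftAlgEquiv (fixedField D)).toLinearEquiv.finiteDimensional
  haveI : IsClosed ((layerN L₁ D : Subgroup (absoluteGaloisGroup k)) :
      Set (absoluteGaloisGroup k)) := by
    rw [layerN_eq_galFixing]
    exact isClosed_galFixing k _
  haveI : (layerS L₁ D D').Normal := normal_layerN'_subgroupOf L₁ hDD hn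
  haveI : IsClosed ((layerS L₁ D D' : Subgroup (layerN L₁ D)) : Set (layerN L₁ D)) := by
    change IsClosed ((Subtype.val : layerN L₁ D → absoluteGaloisGroup k) ⁻¹' (layerN' L₁ D'))
    refine IsClosed.preimage continuous_subtype_val ?_
    rw [show (layerN' L₁ D' : Set (absoluteGaloisGroup k)) = galFixing k (lift (fixedField D')) by
      rw [galFixing_lift_fixedField]]
    exact isClosed_galFixing k _
  -- `H¹(N', K̄ˣ) = 0`
  have h1 : Subsingleton (continuousCohomology 1
      ((layerRep L₁ D).restrict (subgroupIncl (layerS L₁ D D'))).toTopRep) :=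
    (subsingleton_iff_of_continuousMulEquiv (layerSEquiv L₁ hDD)
      ((units k).restrict (subgroupIncl (galFixing k (lift (fixedField D')))))
      ((layerRep L₁ D).restrict (subgroupIncl (layerS L₁ D D'))) (fun _ _ => rfl) 1).1
      (subsingleton_one_units_galFixing (lift (fixedField D')))
  -- the quotient `N/N'` is finite cyclic of order `p`, discrete
  have hSopen : IsOpen ((layerS L₁ D D' : Subgroup (layerN L₁ D)) : Set (layerN L₁ D)) := by
    change IsOpen ((Subtype.val : layerN L₁ D → absoluteGaloisGroup k) ⁻¹' (layerN' L₁ D'))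
    refine IsOpen.preimage continuous_subtype_val ?_
    rw [show (layerN' L₁ D' : Set (absoluteGaloisGroup k)) = galFixing k (lift (fixedField D')) by
      rw [galFixing_lift_fixedField]]
    exact isOpen_galFixing k _
  haveI : DiscreteTopology (layerN L₁ D ⧸ layerS L₁ D D') := QuotientGroup.discreteTopology hSopen
  have hcard : Nat.card (layerN L₁ D ⧸ layerS L₁ D D') = p := by
    rw [← Subgroup.index_eq_card]
    change (layerN' L₁ D').relIndex (layerN L₁ D) = p
    have h := relIndex_galFixing_lift_fixedField L₁ D' D
    rw [galFixing_lift_fixedField, galFixing_lift_fixedField] at h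
    rw [h, hindex]
  haveI : Finite (layerN L₁ D ⧸ layerS L₁ D D') := Nat.finite_of_card_ne_zero (by
    rw [hcard]; exact hp.out.ne_zero)
  letI : Fintype (layerN L₁ D ⧸ layerS L₁ D D') := Fintype.ofFinite _
  haveI : IsCyclic (layerN L₁ D ⧸ layerS L₁ D D') := isCyclic_of_prime_card hcard
  obtain ⟨s, hs⟩ := IsCyclic.exists_generator (α := layerN L₁ D ⧸ layerS L₁ D D')
  -- `H²(N/N', (K̄ˣ)^{N'}) = 0`
  have h2 : Subsingleton (continuousCohomology 2
      ((layerRep L₁ D).quotientInvariants (layerS L₁ D D')).toTopRep) :=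
    subsingleton_two_of_forall_exists_norm_eq _ s hs
      (exists_norm_eq_of_norm_surjective L₁ hDD hn hNorm)
  exact exists_d_eq_of_res_eq_d_two (layerS L₁ D D') (layerRep L₁ D) h1 h2 a ha hres

end Layer

end Literature.NumberTheory.GaloisRepresentations

end
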